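import Mathlib
import HarnessLib
import HarnessLib.Audit
import Summits.ValiantsHypothesis.Statement
import Literature.NumberTheory.DiophantineGeometry.SchurWeylPlethysm
import Literature.Computability.AlgebraicComplexity.OrbitClosure
import Summits.ValiantsHypothesis.ValiantsHypothesis.Theorems.BorderApolarityGctBridgeRoute
import HarnessLib.Audit.Status.Attr

/-!
Route: ValuativeGCT

CLOSED (exhausted) 2026-08-17T15:37:35Z by planner-rbadge-ValiantsHypothesis-ValuativeGCT-b07f39af-0 — reason: exhausted — note: ROUTE-REPAIR CLOSE (planner rbadge, 2026-08-17): route closed EXHAUSTED at summit strength; nothing refuted, all science landed. WHY: pre-birth tribunal FAILED x2 (retro round 0, 15:04Z/15:28Z), T1(c) summit-strength: sole open load-bearing binder of `closes` is TailFlip, the other four (ValuativeBo. The file is kept as the record of this route; refuted decls are indexed as negative knowledge (`ledger negatives`).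

# Route ValuativeGCT — Edmonds-gap valuations truncate the Kronecker bound — K_m(λ) ≤ dim T_U(λ) —
and a truncated multiplicity flip in the quasi-polynomial window

It suffices to show X = ValuativeBound ∧ ValuativeFlip (card valuative-gct-edmonds-divisors, spine).
ValuativeBound: for every
linear space U of m×m matrices of rank ≤ r, the multiplicity K_m(λ) of V(λ)* in the coordinate ring
ℂ[Δ(det_m)] of the orbit closure of
the determinant is at most dim T_U(λ), where T_U(λ) ⊂ ℂ[End ℂ^(m×m)] is the VALUATIVE TRUNCATION:
Stab(det_m)-invariant highest-weight
vectors of weight λ* and degree mδ that vanish to order ≥ δ(m − r) along L_U = {A : rowspace A ⊆ U}.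
For U = 0 this is BLMW's symmetric
Kronecker bound; for an Edmonds-gap space (rk U < m = ncrk U, e.g. skew matrices, m odd) it is
strictly smaller (CutBites), and for m = 3 the card identifies it
with the multiplicity in the NORMALISATION of Δ(det₃) (one blow-up, arXiv:1512.02437).
ValuativeFlip: in the quasi-polynomial window n ≤ m ≤ 2^((log₂ n + c)^c) some
truncation drops below the multiplicity of λ* in ℂ[Δ(X₀₀^(m−n) per_n)]. Bound ∧ Flip give a
multiplicity obstruction (GCTMult.GctMultFlip,
shared principle GctMultPrinciple), hence the quasi-polynomial Mulmuley–Sohoni thesis, hence VP_ℂ ≠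
VNP_ℂ through the shared glue GctToVH.
Lean: `ValuativeBound ∧ ValuativeFlip`

## Assembly
Pure logic, sorry-free in Sketch.lean / glue.lean (axioms propext, Classical.choice, Quot.sound).
From rev 4 (route-repair
2026-08-16) the deciding theorem `closes` takes the two CHILDREN of ValuativeFlip — HeadFlip (flips
on some linear head
n ≤ m ≤ (a/b)·n) and TailFlip (flips above every slope up to the top of every window) — together
with ValuativeBound,
GctMultPrinciple, GctToVH, and first re-derives ValuativeFlip inline (case split on b·m ≤ a·n; the
glue is the support item
ValuativeFlipSplit, its converses ValuativeFlipToHead / ValuativeFlipToTail make the split an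
equivalence, all three proved in
the repair sketch). Then as before: fix c; ValuativeFlip gives n₀ and, for n ≥ n₀ and m in the
window, (U, r, δ, λ) with
dim T_U < mult_pp(λ*); ValuativeBound gives mult_det(λ*) ≤ dim T_U; GctMultPrinciple turns
mult_det(λ*) < mult_pp(λ*) into
X₀₀^(m−n) per_n ∉ Δ(det_m); GctToVH (MS2001 Prop 4.4 + dc bookkeeping + hub, all over discharged
facts) gives VP_ℂ ≠ VNP_ℂ.
ValuativeFlip (the parent, claimable for a direct proof: it discharges both children by the
converses), CutBites,
OrbitMapKernel, CoeffVanishingOrder, NoValuativeFlip and the three glue supports are not hypotheses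
of `closes`.

Rationale: WHY THIS LINE. The non-normality of Δ(det_m) — the recorded "main difficulty" of multiplicity-based
GCT (arXiv:1511.02927 §1; arXiv:2406.06217 §7.4: "hardly
anything is known about K_n(λ)") — is located and used: by Hüttenhain's criterion (arXiv:1512.04352
Thm 4) ℂ[Nor Δ(det_m)] sits inside
ℂ[End W]^Stab and differs from it exactly through End-semistable a with det_m∘a = 0, i.e. (King /
Ivanyos–Qiao–Subrahmanyam / Derksen–Makam)
through linear spaces of singular matrices of full non-commutative rank (Edmonds-gap spaces), whose
limits span boundary divisors of Det_m
(arXiv:1004.4802 Prop 3.5.1, arXiv:1512.02437 Thm 1). The valuative criterion for integral closure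
of powers of the ideal of coefficients of
det_m(xA) turns "regular on the normalisation" into a weight cut, and the cut is an UPPER bound on
K_m(λ) for every singular U with no Rees
theory needed (ValuativeBound). Imported: commutative algebra (integral closure, order-of-vanishing
valuations), GIT of the left-right action
(nc-rank, null cone), highest-weight theory already in tree (orbitMultiplicity, detFormLex,
paddedPerFormLex). What it does that GCTMult /
IntegralGCT / BorderApolarity do not: it replaces the det-side Kronecker coefficient g(λ, m×d, m×d)
— positive throughout the useful range
(arXiv:1512.03798 Thm 4) and NP-hard to decide — by the dimension of an explicitly filtered
subspace, strictly below the symmetric Kronecker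
count, computed without deciding any positivity; the negatives index (3 refuted statements: elusive
candidate, Grenet rigidity) is untouched.

RANKED CRUXES. #2 ValuativeFlip (crux) — VALUATIVE FLIP (card K1, Edmonds-gap truncation beats the
padded permanent). For every c and all large n, for every m in the quasi-polynomial window n <= m <=
2^((log2 n + c)^c), there are a linear space U of m x m matrices all of rank <= r (a singular space
when r < m; the intended witnesses are Edmonds-gap spaces, rk < ncrk = m, e.g. the skew-symmetric
matrices for odd m), a degree delta and a partition lam of m*delta with <= m^2 parts such that the
VALUATIVE TRUNCATION T_U(lam) -- the space of polynomial functions G on End(C^{m x m}) (variables =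
entries A j i) that are homogeneous of degree m*delta, vanish to order >= delta*(m - r) along L_U =
{A : every row of A lies in U} (membership in the delta(m-r)-th power of the vanishing ideal of
L_U), are invariant under A -> A*M for every M in the End-stabiliser of det_m (linSubst M det_m =
det_m), and are B-semi-invariants of weight lam* = (dualOfPartition (m*m) lam).toMatIdx for the
upper-triangular Borel of GL(MatIdx m) acting by G -> (A -> G(g^{-1} A)) (the transport of coordRep)
-- has dimension STRICTLY SMALLER than the multiplicity of lam* in C[Delta(X00^{m-n} per_n)]
(orbitMultiplicity of paddedPerFormLex). With ValuativeBound this is a multiplicity obstruction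
(GctMultFlip of route GCTMult) whose determinant side is an explicit weight census instead of the
unknown K_m(lam); it is implied by GctKroneckerFlip (U = 0 gives the symmetric Kronecker space) and
is strictly roomier. [deps: ValuativeBound] [difficulty: open-problem] (why it might fail: dim
T_U(lam) may dominate the padded-permanent multiplicity throughout the window exactly as g(lam, m x
d, m x d) does (IP17 Thm 4: for m > 3n^4, mult_pp(lam) > 0 forces g > 0); no lower-bound engine for
mult_pp beyond inner shapes / IK20 rectangle shifts; open already for m < 2n.) [arXiv:1911.03990,
arXiv:1512.03798, arXiv:1604.06431, KadishLandsberg2014, arXiv:1512.04352, arXiv:0907.2850]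
#3 ValuativeBound (crux) — VALUATIVE BOUND (card K2 demoted to the unconditional inequality, triage
note (b)): for every m >= 1, every linear space U of m x m matrices all of rank <= r, every delta
and every lam |- m*delta with <= m^2 parts, the multiplicity K_m(lam) of lam* in C[Delta(det_m)]
(orbitMultiplicity of detFormLex) is AT MOST dim T_U(lam) (the truncation of ValuativeFlip with
threshold t = delta*(m - r) in degree m*delta). Mechanism: the End-orbit pull-back Phi :
C[coefficients] -> C[End W], F -> (A -> F(det_m(x A))), kills exactly I(GL.det_m) (OrbitMapKernel),
intertwines coordRep with G -> G(g^{-1} A), lands in the Stab-invariants, and sends degree-delta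
functions into P_U^{delta(m-r)} because every coefficient of det_m(xA) vanishes to order >= m - r
along L_U (CoeffVanishingOrder: column expansion, > r columns from a rank-<= r matrix are
dependent); so the weight-lam* highest-weight space of C[Delta(det_m)] injects into T_U(lam).
Huttenhain 2017 Thm 4 (C[Nor Delta] inside C[End W]^H) plus the valuative criterion for integral
closure is the conceptual source; for U = 0 or r >= m the bound degenerates to the symmetric
Kronecker bound of BLMW Prop 5.2.1. [deps: OrbitMapKernel, CoeffVanishingOrder] [difficulty: L] (why
it might fail: New, unpublished bound: needs ker(End-orbit pull-back) = I(GL.det_m) (density of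
GL_{m^2}), transport of B-semi-invariance in the dual coordRep convention, and P_U^t = order-t
vanishing along L_U; a slip in any convention (side of an action, dual weight) breaks the inequality
as typed.) [arXiv:1512.04352, arXiv:0907.2850, arXiv:1512.02437, arXiv:1511.02927,
Literature.NumberTheory.DiophantineGeometry.orbitMultiplicity_det_le_kroneckerCoeff]
#4 CutBites (crux) — THE CUT BITES (card K3, truncation calculus, first rung): for every odd m >= 3
the skew-symmetric Edmonds-gap space Lambda_m (singular, generic rank m-1, so threshold t = delta)
truncates strictly somewhere: there are delta and lam |- m*delta (<= m^2 parts) with dim T_Lambda(t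
= delta, lam*) < dim T_Lambda(t = 0, lam*), the latter being the untruncated space of
Stab(det_m)-invariant highest-weight vectors (the symmetric Kronecker count). At m = 3, delta = 2
the card computes T = types (6)+(4,2) against (6)+(4,2)+(2,2,2). The informative continuation (layer
2, not filed): a formula / lower bound for dim T_0 - dim T_delta on Kadish-Landsberg shapes via
restriction to all-skew arguments and the first fundamental theorem for GL_m. [difficulty: M] (why
it might fail: Verified only at m = 3, delta = 2 (type (2,2,2) is cut; card toy, numerics); for m >=
5 every Stab(det_m)-invariant may already vanish to order deg/m along L_Lambda (v_Lambda not a Rees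
valuation of I_m, or detecting nothing), so T_Lambda = the full symmetric-Kronecker space.)
[arXiv:1512.02437, arXiv:1004.4802, arXiv:1512.04352, doi:10.1007/s13366-019-00466-7,
KadishLandsberg2014]
#5 HeadFlip (crux) — LINEAR HEAD of the window (strategist split of #2, 2026-08-16; line
Cruxes/ValuativeFlip/Lines/four-row-count): for SOME slope a/b > 1, eventually in n, at every n <= m
<= (a/b) n some valuative truncation (indeed U = bot on a <= 4-row shape, an sk-flip) lies strictly
below mult_{lam*} C[Delta_m(X00^{m-n} per_n)]. Four-row count: on <= 4-row shapes both sides only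
see four rows of A; det side = SL x SL-invariants of 4-tuples of m x m matrices (Krull dim 2m^2+2),
per side = closure{l(y)^{m-n} per_n(M(y))} in Sym^m C^4 (dim 4n^2-2n+5), so the bottom's
Hilbert-function count (landed B1-B6) flips for every m < sqrt2 n; slope 6/5 keeps slack; contains m
= n+1. [difficulty: XL] (why it might fail: needs the 4-variable permanental pencil rank >= 2m^2+m+2
~ 2.9 n^2 for all large n (numerically min(C(n+3,3), 4n^2-2n+2), kit j018409) plus the few-row
restriction principle in the route's dual-weight conventions.) [arXiv:1204.4693, arXiv:0907.2850,
doi:10.1017/9781108183192, doi:10.1307/mmj/1030132707, arXiv:1004.4802]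
#6 TailFlip (crux) — TAIL of the window (the other child of #2; route-repair 2026-08-16 completing
the strategist's split): for EVERY slope a/b > 1 and every c, eventually in n, at every (a/b) n < m
<= 2^((log2 n + c)^c) some valuative truncation T_U(lam) lies strictly below mult_{lam*}
C[Delta_m(X00^{m-n} per_n)] (same flip body as #2). Equivalent, together with #5, to #2 (glue +
converses below). It keeps the WHOLE residual difficulty of #2 — multiplicity obstructions beyond
linear padding (all of c >= 2, and (sqrt2 n, 2n] of c = 1), where no bounded number k of rows flips
the total count (per k n^2-2n+k+1 vs det (k-2)m^2+2) and only isotypic information or a genuine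
Edmonds-gap cut (CutBites) can work. Staffing: #2's chain on #2's hard range — no second chain
before #5 lands. [difficulty: open-problem] (why it might fail: exactly #2's risk on its range: dim
T_U(lam) may dominate mult_pp throughout superlinear padding as Kronecker coefficients do (IP17 Thm
4, m > 3n^4); bounded-length shapes carry no obstruction once m >= 1+n(n+1)^l (landed); no per-side
engine past sqrt2 n.) [arXiv:1512.03798, arXiv:1604.06431, arXiv:1911.03990,
doi:10.4086/toc.gs.2025.010, arXiv:0907.2850]
#9 GctMultPrinciple (support) — Multiplicity obstruction principle, weight form (shared verbatim
with route GCTMult, stmt-ValiantsHypothesis-0889; known, MulmuleySohoni2008 / BLMW2011 Prop 3.3.2):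
a highest weight with larger multiplicity in C[Delta(padded per_n)] than in C[Delta(det_m)] forces
X00^{m-n} per_n outside Delta(det_m). [difficulty: provable-now] [arXiv:0907.2850,
MulmuleySohoni2008, arXiv:1604.06431]
#9 GctToVH (support) — Shared glue (verbatim stmt-ValiantsHypothesis-0983 of routes IntegralGCT /
BorderApolarity): the quasi-polynomial border thesis (padded per_n outside Delta(det_m) for all
large n and all n <= m <= 2^((log2 n + c)^c)) implies VP_C != VNP_C, via MS2001 Prop 4.4
(paddedPerPoly_mem_orbitClosure_detPoly_of_hasDetRepr_holds), attainment and padding of dc, VP =>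
qp-bounded dc (isQPBounded_determinantalComplexity_of_isVPFamily_holds), the renaming bridge and per
in VNP (Theorems/HubHub.lean). Bookkeeping over discharged facts. [difficulty: provable-now]
[MulmuleySohoni2001, arXiv:0907.2850, Burgisser2000]
#9 OrbitMapKernel (support) — Kernel of the End-orbit pull-back (feeds ValuativeBound): a polynomial
F in the degree-m coefficients vanishes on the GL_{m^2}-orbit of det_m iff F(coefficients of det_m(x
A)) is the zero polynomial in the entries of the generic matrix A (GL is Zariski dense in End over
C: multiply by det A). Elementary. [difficulty: provable-now] [arXiv:0907.2850, MulmuleySohoni2001,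
Literature.Computability.AlgebraicComplexity.endOrbit_subset_orbitClosure]
#9 CoeffVanishingOrder (support) — The valuative estimate (feeds ValuativeBound): if every matrix in
the linear space U has rank <= r then every coefficient (in x) of det_m(x A), as a polynomial in the
entries of A, lies in the (m - r)-th power of the vanishing ideal of L_U = {A : all rows in U}:
expand det(Y0 + Y1) column-wise with Y0 = (xA0) of rank <= r over C(x); terms with more than r
columns from Y0 vanish, the rest have >= m - r columns linear in A1; powers of the ideal of a linear
subspace are the order-of-vanishing ideals. [difficulty: provable-now] [arXiv:1512.02437,
arXiv:1004.4802]
#9 NoValuativeFlip (support) — NEGATIVE SIDE / kill statement (the card's fastest refutation,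
valuative analogue of GCTMult.GctNoMultBarrier): from some polynomial padding m >= n^{c0} on, for
EVERY singular-space truncation (U, r) and every (delta, lam) the padded-permanent multiplicity of
lam* is at most dim T_U(lam). A proof refutes ValuativeFlip (the window contains m = n^{c0}) and is
evidence for GctNoMultBarrier (stmt-0890). Filed unranked; rank it if CutBites dies for m >= 5.
[difficulty: open-problem] [arXiv:1604.06431, arXiv:1512.03798, doi:10.4086/toc.gs.2025.010]
#9 ValuativeFlipSplit (support) — GLUE of the split: HeadFlip -> TailFlip -> ValuativeFlip (pure
logic: n0 = max of the two thresholds, case split on b m <= a n; sorry-free `ValuativeFlip_of_subs`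
in Cruxes/ValuativeFlip/Split.lean = `valuativeFlipSplit_proof` in the repair sketch; land it as
`theorem ... : ValuativeGCT.ValuativeFlipSplit` under Theorems). From rev 4 `closes` takes the
CHILDREN as binders (ValuativeBound, HeadFlip, TailFlip, GctMultPrinciple, GctToVH) and re-derives
ValuativeFlip inline by this logic (the BorderApolarity / ToricReduction pattern), so #2 stays in
the cone through the proof term; the item docstring's remark that `closes` keeps ValuativeFlip as a
hypothesis describes rev 3 only. [difficulty: provable-now] [this route]
#9 ValuativeFlipToHead (support) — CONVERSE glue: ValuativeFlip -> HeadFlip (slope 2/1, window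
exponent c = 2: m <= 2n < 2^(log2 n + 2) <= 2^((log2 n + 2)^2); `valuativeFlipToHead_proof` in the
sketch, ~10 lines). With ValuativeFlipToTail the split is an EQUIVALENCE ValuativeFlip <-> HeadFlip
∧ TailFlip: a DIRECT proof of #2 discharges both children of `closes` by one line each, and the
views show them as derived from #2 once these land. [difficulty: provable-now] [this route]
#9 ValuativeFlipToTail (support) — CONVERSE glue: ValuativeFlip -> TailFlip (restriction to the
tail: a n < b m with b < a forces n < m; `valuativeFlipToTail_proof` in the sketch, 8 lines).
[difficulty: provable-now] [this route]

TWO-LAYER PLAN. FILED 2026-08-16 (strategist + route-repair): ValuativeFlip ⇔ HeadFlip ∧ TailFlip —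
glue item ValuativeFlipSplit (HeadFlip → TailFlip → ValuativeFlip) and converses
ValuativeFlipToHead, ValuativeFlipToTail, all three proved in the repair sketch; `closes` (rev 4)
has binders ValuativeBound, HeadFlip, TailFlip, GctMultPrinciple, GctToVH and derives ValuativeFlip
inline, so the open leaves of the deciding theorem are {HeadFlip, TailFlip}, equivalently
{ValuativeFlip}. HeadFlip is attacked by line four-row-count (skeleton
Cruxes/ValuativeFlip/Lines/four_row_count.lean: stubs fourRowSliceBound, fourRowPencilRank
[load-bearing], fourRowHilbertLowerBound, fourRowBridge, templates = landed B1/B3/B4/B6 of the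
bottom window); TailFlip is the honestly-labelled residual and gets no children until HeadFlip
lands. The foreseen splits of ValuativeBound and CutBites are moot (both proved directly). Layer
count: cruxes {ValuativeFlip, ValuativeBound, CutBites} + children {HeadFlip, TailFlip} of
ValuativeFlip — two layers, nothing below.

KILL CRITERIA. NoValuativeFlip proved ⇒ ValuativeFlip is refuted inside the window (m = n^c₀ ≤
2^((log₂ n + c₀ + 1)^(c₀+1))) — close `refuted:ValuativeFlip`.
CutBites refuted for all odd m ≥ 5 AND the same for the other Edmonds-gap candidates (Λ_(m−1) ⊕
E_mm, …) ⇒ the truncation is the symmetric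
Kronecker space in the window and the route degenerates to GCTMult.GctKroneckerFlip with sk in place
of g — close `superseded --by
route-ValiantsHypothesis-GCTMult`. ValuativeBound refuted at m = 3 by an explicit orbit-closure
function violating the cut ⇒ substantive, the
mechanism is dead — close `refuted:ValuativeBound`; refuted only through a convention (dual weight /
side of action) ⇒ misstated, repair by a
restated item. X₀₀^(m−n) per_n ∈ Δ(det_m) for some m = 2^(polylog n) kills every GCT route at once
(shared with GCTMult). HeadFlip refuted (a <= 4-row no-go at m = n+1, or the four-variable
permanental pencil rank provably < 2(1+eta)^2 n^2 for every eta > 0) ⇒ `route edit --drop HeadFlip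
--drop TailFlip --drop ValuativeFlipSplit --drop ValuativeFlipToHead --drop ValuativeFlipToTail
--closes-file <rev-3 glue: binders ValuativeBound, ValuativeFlip, GctMultPrinciple, GctToVH>` (kept
in the repair folder as glue.rev3.lean), #2 stays whole and the thesis is unchanged — NOTE HeadFlip
is implied by #2 (ValuativeFlipToHead), so a refutation of HeadFlip refutes #2 as well and the
honest close is then `refuted:ValuativeFlip`; TailFlip refuted for some slope ⇒ #2 is refuted by the
same witness (TailFlip is implied by #2): handle as refuted:ValuativeFlip.

NOT DECOMPOSED YET. The choice of U for even m (Λ_(m−1) ⊕ E_mm or another full-ncrk singular space);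
the Rees / divisor theorem (card K2: v_Λ is the Rees
valuation of I_m centred on the skew boundary divisor, exactness K̃_m = dim T_Λ) — deliberately NOT
filed, the bound does not need it; which
(λ, d) to target (padding forces λ₁ ≥ d(m−n), ≤ m²+1 parts: barrier GCTUsefulModules); a named Lean
notion for T_U / nc-rank (signatures
inline the truncation; a definition item can supersede them once a prover wants it); the per-side
lower-bound engine beyond sqrt2 n (= TailFlip's future lines, the one place where the Edmonds-gap
cut can be NEEDED for a flip). All are layer-2 matters; TailFlip is already a layer-2 item, so its
lines attach as `--supports`, never as items.

CHEAPEST FALSIFIER. m = 3, δ = 2 (degree 6), U = Λ₃ (skew 3×3, t = 2): compute dim T_Λ(λ*) for λ ∈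
{(6), (4,2), (2,2,2)} by linear algebra on the three
Stab(det₃)-invariant highest-weight vectors (symmetric Kronecker sk = (1,1,1); closure
multiplicities K₃ = (1,1,0) from h₂∘h₃ = s₆ + s₄₂).
Expected (card, by hand + numerics, kit jobs j003221/j003248 never ran): (1,1,0). Outcome (1,1,1)
kills CutBites at m = 3 and the exactness
claim; any value below (1,1,0) REFUTES ValuativeBound outright. Second: look up Hüttenhain's TU
Berlin thesis (2017) for ℂ[Nor Det₃]
multiplicities. I could not run it here (hub compute-free, kit queue not used by planners).

NUMBERS. K₃ vs sk in degree 2: (1,1,0) vs (1,1,1) on (6), (4,2), (2,2,2) (card; BLMW §5). No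
occurrence obstructions once m ≥ n^25 (arXiv:1604.06431
Thm 1.1); for m > 3n⁴, mult_pp(λ) > 0 forces g(λ, m×d, m×d) > 0 (arXiv:1512.03798 Thm 4, p.4);
occurring λ need λ₁ ≥ d(m−n) and ≤ m²+1
parts (KadishLandsberg2014 Thm 1.2); ℂ[Nor Det_m] ≠ ℂ[GL·det_m]_poly for m ≥ 3 (Landsberg 2017 Rem
9.7.2.3; arXiv:1512.04352 Thm 4 with
the skew witness); boundary of Det₃ = two components, one blow-up resolution (arXiv:1512.02437 Thm
1). Items at open: 9 (3 cruxes, 5 support, 1 assembly). After the 2026-08-16 split (rev 4): 14 items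
(5 cruxes — ValuativeBound, CutBites proved; ValuativeFlip, HeadFlip, TailFlip open —, 8 support of
which 3 are provable-now glue (ValuativeFlipSplit, ValuativeFlipToHead, ValuativeFlipToTail), 1
assembly). Four-row numerics (strategist, kit j018409, exact mod-p ranks): dim R_4(per_n) =
min(C(n+3,3), 4n^2-2n+2) for n <= 10, dim R_k(per_n) = k n^2-2n+2 on the nose at k = 5 (n = 5,6,7)
and k = 6 (n = 4,5,6); det analogue (k-2)n^2+2; hence the head flips for n <= m < sqrt2 n - O(1).

DEFINITION REQUESTS. None required: every item is typed over existing declarations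
(orbitMultiplicity, detFormLex, paddedPerFormLex, Weight.dualOfPartition,
IsUpperTriangular, weightChar, linSubst, DegIdx, orbitVanishingIdeal, MvPolynomial.vanishingIdeal,
homogeneousSubmodule); the truncation
T_U is inlined as a `let`. A named `valuativeTruncation` / `ncRank` under
Summits/ValiantsHypothesis/ValiantsHypothesis/Theorems would shorten
the signatures and may be requested by the first prover; not load-bearing.

Novelty: Searches (2026-08-15, this seat; card's own search log in the card): `lit galaxy search
"normalization of the orbit closure" --star all` (1:
Tirao–Wallach Progress in Math. 105, irrelevant); `"coordinate ring of the orbit closure of the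
determinant" --star all` (1: Landsberg 2017
book, panama:19447611916410); `"stabilizer of the determinant and its orbit closure" --star all`
(0); `--star pdf "non-commutative rank"` (13:
IQS17, DerksenMakam, operator scaling, EGOW17 rank barriers — none on orbit-closure multiplicities);
`lit search --source zbmath "orbit
closure of the determinant"` (15: arXiv:1604.06431, arXiv:0907.2850, arXiv:1511.02927,
arXiv:1109.5996, arXiv:1007.1695, arXiv:1501.05528,
doi:10.1007/s13366-019-00466-7 Ressayre 2020 vanishing symmetric Kronecker coefficients); `--source
zbmath "Hüttenhain"` (arXiv:1512.02437,
arXiv:1512.04352, arXiv:1410.8202, arXiv:1607.08419); `lit frontier ValiantsHypothesis --since 2021`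
(30 rows, none on normalisations /
boundary divisors; arXiv:2606.08363 noted); `lit read arxiv:1512.03798` p.4 (Thm 4 verbatim).
searchd hybrid and OpenAlex unavailable (rc 75 / 429).
Nearest prior art found: arXiv:1512.04352 (Hüttenhain 2017) Thm 4 — ℂ[Nor closure(Gw)] ↪ ℂ[End W]^H
with an abstract equality criterion, no
per-divisor valuation and no multiplicity bound; arXiv:1512.02437 (Hüttenhain–Lairez 2016) — the two
boundary components of Det₃ and the
one-blow-up resolution, no coordinate ring; arXiv:0907.2850 Prop 5.2.1 — the Kronecker upper bound  [refs: 10.1007/s13366-019-00466-7, 1604.06431, 0907.2850, 1511.02927, 1109.5996, 1007.1695, 1501.05528, 1512.02437, 1512.04352, 1410.8202, 1607.08419, 2606.08363, 1512.03798, 1911.03990, doi:10.1007/s13366-019-00466-7, arxiv:1512.03798]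

Barriers (technique_class: GCT, multiplicity-obstructions, valuative-normalization): - technique_class: GCT, multiplicity-obstructions, valuative-normalization
- Literature.Barriers.ValiantsHypothesis.KroneckerPlethysmHardness: evaded — no Kronecker / plethysm
coefficient is ever decided positive or zero; the det side is the dimension of an explicitly
filtered subspace (weights of a fixed one-parameter subgroup on Stab-invariants), the per side needs
lower bounds only; residual honesty: evaluating dim T_U exactly for huge λ is still #P-flavoured
(BDI21), but the cruxes ask for inequalities on families, proved structurally.
- Literature.Barriers.ValiantsHypothesis.GCTOccurrenceObstructions: evaded — every crux compares
multiplicities (dim T_U vs orbitMultiplicity of the padded permanent), the evasion the entry itself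
records; every closure function, in particular BIP's padded power sums, passes the cut, so the
mechanism is consistent with no-occurrence at m ≥ n^25; the bet: some λ has mult_pp > dim T_U ≥ K_m
> 0.
- Literature.Barriers.ValiantsHypothesis.NotViaSaturations: evaded — dim T_U(λ) is not a function of
the saturation / cone of occurring weights; it is hole-sensitive by construction (it measures poles
along boundary divisors, the non-normality BHI point at).
- Literature.Barriers.ValiantsHypothesis.GCTUsefulModules: respected, not evaded — a flip must live
on Kadish–Landsberg shapes (λ₁ ≥ d(m−n), ≤ m²+1 parts); T_U commutes with first-row padding
(evaluation highest-weight vector shift), so the cut is analysed on inner shapes and transported;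
CutBites

History (route lifecycle, newest last):
- 2026-08-17T15:37:35Z · CLOSED exhausted — exhausted (planner-rbadge-ValiantsHypothesis-ValuativeGCT-b07f39af-0)

sub-problem: ValiantsHypothesis · status: closed(exhausted) · opened planner-plancard-ValiantsHypothesis-ValiantsH-0bf8af2b-0 2026-08-15T18:58:15Z · rev 4 · ledger route-ValiantsHypothesis-ValuativeGCT
GENERATED by the gate from the ledger (D-0016/17). Provers cite these decls: `theorem foo : Summit.ValiantsHypothesis.ValiantsHypothesis.Theses.ValuativeGCT.<Decl> := …` in Summits/ValiantsHypothesis/ValiantsHypothesis/Theorems/<Name>.lean.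
-/

namespace Summit.ValiantsHypothesis.ValiantsHypothesis.Theses.ValuativeGCT

open scoped BigOperators Topology Manifold Classical MeasureTheory ProbabilityTheory Matrix InnerProductSpace ComplexConjugate ContinuousMap
open Filter Set Function TopologicalSpace MeasureTheory

attribute [summit_statement] _root_.ValiantsHypothesis

open Literature.PNP

/-- item stmt-ValiantsHypothesis-12624 · crux · rank 2 · closed · moot by None · by planner
why it might fail: dim T_U(lam) may dominate the padded-permanent multiplicity throughout the window exactly as g(lam, m x d, m x d) does (IP17 Thm 4: for m > 3n^4, mult_pp(lam) > 0 forces g > 0); no lower-bound engine for mult_pp beyond inner shapes / IK20 rectangle shifts; open already for m < 2n.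
sources: arXiv:1911.03990, arXiv:1512.03798, arXiv:1604.06431, KadishLandsberg2014, arXiv:1512.04352, arXiv:0907.2850
[crux] VALUATIVE FLIP (card K1, Edmonds-gap truncation beats the padded permanent). For every c and
all large n, for every m in the quasi-polynomial window n <= m <= 2^((log2 n + c)^c), there are a
linear space U of m x m matrices all of rank <= r (a singular space when r < m; the intended
witnesses are Edmonds-gap spaces, rk < ncrk = m, e.g. the skew-symmetric matrices for odd m), a
degree delta and a partition lam of m*delta with <= m^2 parts such that the VALUATIVE TRUNCATION
T_U(lam) -- the space of polynomial functions G on End(C^{m x m}) (variables = entries A j i) that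
are homogeneous of degree m*delta, vanish to order >= delta*(m - r) along L_U = {A : every row of A
lies in U} (membership in the delta(m-r)-th power of the vanishing ideal of L_U), are invariant
under A -> A*M for every M in the End-stabiliser of det_m (linSubst M det_m = det_m), and are
B-semi-invariants of weight lam* = (dualOfPartition (m*m) lam).toMatIdx for the upper-triangular
Borel of GL(MatIdx m) acting by G -> (A -> G(g^{-1} A)) (the transport of coordRep) -- has dimension
STRICTLY SMALLER than the multiplicity of lam* in C[Delta(X00^{m-n} per_n)] (orbitMultiplicity of
paddedPerFormLex). With Valuati -/
@[route_item "route-ValiantsHypothesis-ValuativeGCT", crux]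
def ValuativeFlip : Prop :=
  ∀ c : ℕ, ∃ n₀ : ℕ, ∀ n ≥ n₀, ∀ (m : ℕ) [NeZero m], n ≤ m → m ≤ 2 ^ ((Nat.log 2 n + c) ^ c) → ∃ (U : Submodule ℂ (Literature.NumberTheory.DiophantineGeometry.MatIdx m → ℂ)) (r δ : ℕ) (lam : Nat.Partition (m * δ)), (∀ u ∈ U, (Matrix.of fun a b : Fin m => u (toLex (a, b))).rank ≤ r) ∧ lam.parts.card ≤ m * m ∧ (let χ : Literature.NumberTheory.DiophantineGeometry.Weight (Literature.NumberTheory.DiophantineGeometry.MatIdx m) := (Literature.NumberTheory.DiophantineGeometry.Weight.dualOfPartition (m * m) lam).toMatIdx; let T : Submodule ℂ (MvPolynomial (Literature.NumberTheory.DiophantineGeometry.MatIdx m × Literature.NumberTheory.DiophantineGeometry.MatIdx m) ℂ) := MvPolynomial.homogeneousSubmodule (Literature.NumberTheory.DiophantineGeometry.MatIdx m × Literature.NumberTheory.DiophantineGeometry.MatIdx m) ℂ (m * δ) ⊓ ((MvPolynomial.vanishingIdeal ℂ {p : Literature.NumberTheory.DiophantineGeometry.MatIdx m × Literature.NumberTheory.DiophantineGeometry.MatIdx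 m → ℂ | ∀ j : Literature.NumberTheory.DiophantineGeometry.MatIdx m, (fun i => p (j, i)) ∈ U}) ^ (δ * (m - r))).restrictScalars ℂ ⊓ (⨅ (M : Matrix (Literature.NumberTheory.DiophantineGeometry.MatIdx m) (Literature.NumberTheory.DiophantineGeometry.MatIdx m) ℂ) (_ : Literature.Computability.AlgebraicComplexity.linSubst (Literature.NumberTheory.DiophantineGeometry.MatIdx m) ℂ M (Literature.NumberTheory.DiophantineGeometry.detFormLex ℂ m) = Literature.NumberTheory.DiophantineGeometry.detFormLex ℂ m), LinearMap.ker ((MvPolynomial.aeval (R := ℂ) fun p : Literature.NumberTheory.DiophantineGeometry.MatIdx m × Literature.NumberTheory.DiophantineGeometry.MatIdx m => ∑ l : Literature.NumberTheory.DiophantineGeometry.MatIdx m, M l p.2 • MvPolynomial.X (p.1, l)).toLinearMap - LinearMap.id (R := ℂ) (M := MvPolynomial (Literature.NumberTheory.DiophantineGeometry.MatIdx m × Literature.NumberTheory.DiophantineGeometry.MatIdx m) ℂ))) ⊓ (⨅ (g : Matrix.GeneralLinearGroup (Literature.NumberTheory.DiophantineGeometry.MatIdx m) ℂ) (_ : Literature.NumberTheory.DiophantineGeometry.IsUpperTriangular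 g), LinearMap.ker ((MvPolynomial.aeval (R := ℂ) fun p : Literature.NumberTheory.DiophantineGeometry.MatIdx m × Literature.NumberTheory.DiophantineGeometry.MatIdx m => ∑ l : Literature.NumberTheory.DiophantineGeometry.MatIdx m, ((g⁻¹ : Matrix.GeneralLinearGroup (Literature.NumberTheory.DiophantineGeometry.MatIdx m) ℂ) : Matrix (Literature.NumberTheory.DiophantineGeometry.MatIdx m) (Literature.NumberTheory.DiophantineGeometry.MatIdx m) ℂ) p.1 l • MvPolynomial.X (l, p.2)).toLinearMap - Literature.NumberTheory.DiophantineGeometry.weightChar χ g • LinearMap.id (R := ℂ) (M := MvPolynomial (Literature.NumberTheory.DiophantineGeometry.MatIdx m × Literature.NumberTheory.DiophantineGeometry.MatIdx m) ℂ))); Module.finrank ℂ ↥T < Literature.NumberTheory.DiophantineGeometry.orbitMultiplicity ℂ (Literature.NumberTheory.DiophantineGeometry.paddedPerFormLex ℂ n m) m χ)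

/-- item stmt-ValiantsHypothesis-12625 · crux · rank 3 · closed · proved by Summit.ValiantsHypothesis.ValiantsHypothesis.Theorems.ValuativeBound.ValuativeBound_proof @ d9820a5c0bac (prover) · by planner
why it might fail: New, unpublished bound: needs ker(End-orbit pull-back) = I(GL.det_m) (density of GL_{m^2}), transport of B-semi-invariance in the dual coordRep convention, and P_U^t = order-t vanishing along L_U; a slip in any convention (side of an action, dual weight) breaks the inequality as typed.
sources: arXiv:1512.04352, arXiv:0907.2850, arXiv:1512.02437, arXiv:1511.02927, Literature.NumberTheory.DiophantineGeometry.orbitMultiplicity_det_le_kroneckerCoeff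
[crux] VALUATIVE BOUND (card K2 demoted to the unconditional inequality, triage note (b)): for every
m >= 1, every linear space U of m x m matrices all of rank <= r, every delta and every lam |-
m*delta with <= m^2 parts, the multiplicity K_m(lam) of lam* in C[Delta(det_m)] (orbitMultiplicity
of detFormLex) is AT MOST dim T_U(lam) (the truncation of ValuativeFlip with threshold t = delta*(m
- r) in degree m*delta). Mechanism: the End-orbit pull-back Phi : C[coefficients] -> C[End W], F ->
(A -> F(det_m(x A))), kills exactly I(GL.det_m) (OrbitMapKernel), intertwines coordRep with G ->
G(g^{-1} A), lands in the Stab-invariants, and sends degree-delta functions into P_U^{delta(m-r)}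
because every coefficient of det_m(xA) vanishes to order >= m - r along L_U (CoeffVanishingOrder:
column expansion, > r columns from a rank-<= r matrix are dependent); so the weight-lam*
highest-weight space of C[Delta(det_m)] injects into T_U(lam). Huttenhain 2017 Thm 4 (C[Nor Delta]
inside C[End W]^H) plus the valuative criterion for integral closure is the conceptual source; for U
= 0 or r >= m the bound degenerates to the symmetric Kronecker bound of BLMW Prop 5.2.1. [deps:
OrbitMapKernel, CoeffVanishi -/
@[route_item "route-ValiantsHypothesis-ValuativeGCT", crux]
def ValuativeBound : Prop :=
  ∀ (m : ℕ) [NeZero m] (U : Submodule ℂ (Literature.NumberTheory.DiophantineGeometry.MatIdx m → ℂ)) (r : ℕ), (∀ u ∈ U, (Matrix.of fun a b : Fin m => u (toLex (a, b))).rank ≤ r) → ∀ (δ : ℕ) (lam : Nat.Partition (m * δ)), lam.parts.card ≤ m * m → let χ : Literature.NumberTheory.DiophantineGeometry.Weight (Literature.NumberTheory.DiophantineGeometry.MatIdx m) := (Literature.NumberTheory.DiophantineGeometry.Weight.dualOfPartition (m * m) lam).toMatIdx; let T : Submodule ℂ (MvPolynomial (Literature.NumberTheory.DiophantineGeometry.MatIdx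 m × Literature.NumberTheory.DiophantineGeometry.MatIdx m) ℂ) := MvPolynomial.homogeneousSubmodule (Literature.NumberTheory.DiophantineGeometry.MatIdx m × Literature.NumberTheory.DiophantineGeometry.MatIdx m) ℂ (m * δ) ⊓ ((MvPolynomial.vanishingIdeal ℂ {p : Literature.NumberTheory.DiophantineGeometry.MatIdx m × Literature.NumberTheory.DiophantineGeometry.MatIdx m → ℂ | ∀ j : Literature.NumberTheory.DiophantineGeometry.MatIdx m, (fun i => p (j, i)) ∈ U}) ^ (δ * (m - r))).restrictScalars ℂ ⊓ (⨅ (M : Matrix (Literature.NumberTheory.DiophantineGeometry.MatIdx m) (Literature.NumberTheory.DiophantineGeometry.MatIdx m) ℂ) (_ : Literature.Computability.AlgebraicComplexity.linSubst (Literature.NumberTheory.DiophantineGeometry.MatIdx m) ℂ M (Literature.NumberTheory.DiophantineGeometry.detFormLex ℂ m) = Literature.NumberTheory.DiophantineGeometry.detFormLex ℂ m), LinearMap.ker ((MvPolynomial.aeval (R := ℂ) fun p : Literature.NumberTheory.DiophantineGeometry.MatIdx m × Literature.NumberTheory.DiophantineGeometry.MatIdx m => ∑ l : Literature.NumberTheory.DiophantineGeometry.MatIdx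 m, M l p.2 • MvPolynomial.X (p.1, l)).toLinearMap - LinearMap.id (R := ℂ) (M := MvPolynomial (Literature.NumberTheory.DiophantineGeometry.MatIdx m × Literature.NumberTheory.DiophantineGeometry.MatIdx m) ℂ))) ⊓ (⨅ (g : Matrix.GeneralLinearGroup (Literature.NumberTheory.DiophantineGeometry.MatIdx m) ℂ) (_ : Literature.NumberTheory.DiophantineGeometry.IsUpperTriangular g), LinearMap.ker ((MvPolynomial.aeval (R := ℂ) fun p : Literature.NumberTheory.DiophantineGeometry.MatIdx m × Literature.NumberTheory.DiophantineGeometry.MatIdx m => ∑ l : Literature.NumberTheory.DiophantineGeometry.MatIdx m, ((g⁻¹ : Matrix.GeneralLinearGroup (Literature.NumberTheory.DiophantineGeometry.MatIdx m) ℂ) : Matrix (Literature.NumberTheory.DiophantineGeometry.MatIdx m) (Literature.NumberTheory.DiophantineGeometry.MatIdx m) ℂ) p.1 l • MvPolynomial.X (l, p.2)).toLinearMap - Literature.NumberTheory.DiophantineGeometry.weightChar χ g • LinearMap.id (R := ℂ) (M := MvPolynomial (Literature.NumberTheory.DiophantineGeometry.MatIdx m × Literature.NumberTheory.DiophantineGeometry.MatIdx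 m) ℂ))); Literature.NumberTheory.DiophantineGeometry.orbitMultiplicity ℂ (Literature.NumberTheory.DiophantineGeometry.detFormLex ℂ m) m χ ≤ Module.finrank ℂ ↥T

/-- item stmt-ValiantsHypothesis-12626 · crux · rank 4 · closed · proved by Summit.ValiantsHypothesis.ValiantsHypothesis.Theorems.CutBitesAdjugate.CutBites_proof (prover) · by planner
why it might fail: Verified only at m = 3, delta = 2 (type (2,2,2) is cut; card toy, numerics); for m >= 5 every Stab(det_m)-invariant may already vanish to order deg/m along L_Lambda (v_Lambda not a Rees valuation of I_m, or detecting nothing), so T_Lambda = the full symmetric-Kronecker space.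
sources: arXiv:1512.02437, arXiv:1004.4802, arXiv:1512.04352, doi:10.1007/s13366-019-00466-7, KadishLandsberg2014
[crux] THE CUT BITES (card K3, truncation calculus, first rung): for every odd m >= 3 the
skew-symmetric Edmonds-gap space Lambda_m (singular, generic rank m-1, so threshold t = delta)
truncates strictly somewhere: there are delta and lam |- m*delta (<= m^2 parts) with dim T_Lambda(t
= delta, lam*) < dim T_Lambda(t = 0, lam*), the latter being the untruncated space of
Stab(det_m)-invariant highest-weight vectors (the symmetric Kronecker count). At m = 3, delta = 2
the card computes T = types (6)+(4,2) against (6)+(4,2)+(2,2,2). The informative continuation (layer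
2, not filed): a formula / lower bound for dim T_0 - dim T_delta on Kadish-Landsberg shapes via
restriction to all-skew arguments and the first fundamental theorem for GL_m. [difficulty: M] -/
@[route_item "route-ValiantsHypothesis-ValuativeGCT"]
def CutBites : Prop :=
  ∀ m : ℕ, Odd m → 3 ≤ m → ∃ (δ : ℕ) (lam : Nat.Partition (m * δ)), lam.parts.card ≤ m * m ∧ (let U : Submodule ℂ (Literature.NumberTheory.DiophantineGeometry.MatIdx m → ℂ) := (Submodule.span ℂ {u : Literature.NumberTheory.DiophantineGeometry.MatIdx m → ℂ | ∀ a b : Fin m, u (toLex (a, b)) = -u (toLex (b, a))}); let χ : Literature.NumberTheory.DiophantineGeometry.Weight (Literature.NumberTheory.DiophantineGeometry.MatIdx m) := (Literature.NumberTheory.DiophantineGeometry.Weight.dualOfPartition (m * m) lam).toMatIdx; let T : ℕ → Submodule ℂ (MvPolynomial (Literature.NumberTheory.DiophantineGeometry.MatIdx m × Literature.NumberTheory.DiophantineGeometry.MatIdx m) ℂ) := fun t => MvPolynomial.homogeneousSubmodule (Literature.NumberTheory.DiophantineGeometry.MatIdx m × Literature.NumberTheory.DiophantineGeometry.MatIdx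 m) ℂ (m * δ) ⊓ ((MvPolynomial.vanishingIdeal ℂ {p : Literature.NumberTheory.DiophantineGeometry.MatIdx m × Literature.NumberTheory.DiophantineGeometry.MatIdx m → ℂ | ∀ j : Literature.NumberTheory.DiophantineGeometry.MatIdx m, (fun i => p (j, i)) ∈ U}) ^ (t)).restrictScalars ℂ ⊓ (⨅ (M : Matrix (Literature.NumberTheory.DiophantineGeometry.MatIdx m) (Literature.NumberTheory.DiophantineGeometry.MatIdx m) ℂ) (_ : Literature.Computability.AlgebraicComplexity.linSubst (Literature.NumberTheory.DiophantineGeometry.MatIdx m) ℂ M (Literature.NumberTheory.DiophantineGeometry.detFormLex ℂ m) = Literature.NumberTheory.DiophantineGeometry.detFormLex ℂ m), LinearMap.ker ((MvPolynomial.aeval (R := ℂ) fun p : Literature.NumberTheory.DiophantineGeometry.MatIdx m × Literature.NumberTheory.DiophantineGeometry.MatIdx m => ∑ l : Literature.NumberTheory.DiophantineGeometry.MatIdx m, M l p.2 • MvPolynomial.X (p.1, l)).toLinearMap - LinearMap.id (R := ℂ) (M := MvPolynomial (Literature.NumberTheory.DiophantineGeometry.MatIdx m × Literature.NumberTheory.DiophantineGeometry.MatIdx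 m) ℂ))) ⊓ (⨅ (g : Matrix.GeneralLinearGroup (Literature.NumberTheory.DiophantineGeometry.MatIdx m) ℂ) (_ : Literature.NumberTheory.DiophantineGeometry.IsUpperTriangular g), LinearMap.ker ((MvPolynomial.aeval (R := ℂ) fun p : Literature.NumberTheory.DiophantineGeometry.MatIdx m × Literature.NumberTheory.DiophantineGeometry.MatIdx m => ∑ l : Literature.NumberTheory.DiophantineGeometry.MatIdx m, ((g⁻¹ : Matrix.GeneralLinearGroup (Literature.NumberTheory.DiophantineGeometry.MatIdx m) ℂ) : Matrix (Literature.NumberTheory.DiophantineGeometry.MatIdx m) (Literature.NumberTheory.DiophantineGeometry.MatIdx m) ℂ) p.1 l • MvPolynomial.X (l, p.2)).toLinearMap - Literature.NumberTheory.DiophantineGeometry.weightChar χ g • LinearMap.id (R := ℂ) (M := MvPolynomial (Literature.NumberTheory.DiophantineGeometry.MatIdx m × Literature.NumberTheory.DiophantineGeometry.MatIdx m) ℂ))); Module.finrank ℂ ↥(T δ) < Module.finrank ℂ ↥(T 0))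

/-- item stmt-ValiantsHypothesis-15535 · crux · rank 5 · closed · proved by Summit.ValiantsHypothesis.ValiantsHypothesis.Theorems.HeadFlip.HeadFlip_proof @ 8a3cbf1c4cec (prover) · by planner
why it might fail: Rests on the four-row count: needs the 4-variable permanental pencil rank dim span{y_t Per_ij(M)} >= ~2.9 n^2 certified for all large n (numerically min(C(n+3,3), 4n^2-2n+2); kit j018409), plus the few-row restriction principle in the route's dual-weight/left-translation conventions; a hidden degene
sources: arXiv:1204.4693, arXiv:0907.2850, doi:10.1017/9781108183192, doi:10.1307/mmj/1030132707, arXiv:1004.4802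
[crux] LINEAR HEAD of the window (strategist split of ValuativeFlip, 2026-08-16): for SOME rational
slope a/b > 1, for all large n and every n <= m <= (a/b) n, some valuative truncation T_U(lam)
(indeed the no-cut one, U = bot, an sk-flip) is strictly below mult_{lam*} C[Delta_m(X00^{m-n}
per_n)]. Mechanism (line Cruxes/ValuativeFlip/Lines/four-row-count): on shapes with <= 4 rows both
sides only see four rows of A; det side = invariants of 4-tuples of m x m matrices under SL x SL
(Krull dim 2m^2+2, determinantal quaternary forms), per side = closure{l(y)^{m-n} per_n(M(y))} in
Sym^m C^4 of dimension 4n^2-2n+5 (per's stabiliser is a torus); the bottom's Hilbert-function count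
(B1-B6) then flips for every m < sqrt2 n; slope 6/5 keeps slack. Contains the smallest padded case m
= n+1; first multiplicity obstructions above the bottom. Children glue: HeadFlip -> TailFlip ->
ValuativeFlip (Split.lean, pure logic). (why it might fail: Rests on the four-row count: needs the
4-variable permanental pencil rank dim span{y_t Per_ij(M)} >= ~2.9 n^2 certified for all large n
(numerically min(C(n+3,3), 4n^2-2n+2); kit j018409), plus the few-row restriction principle in the
route's dual-weight/left -/
@[route_item "route-ValiantsHypothesis-ValuativeGCT"]
def HeadFlip : Prop :=
  ∃ a b : ℕ, b < a ∧ ∃ n₀ : ℕ, ∀ n ≥ n₀, ∀ (m : ℕ) [NeZero m], n ≤ m → b * m ≤ a * n → ∃ (U : Submodule ℂ (Literature.NumberTheory.DiophantineGeometry.MatIdx m → ℂ)) (r δ : ℕ) (lam : Nat.Partition (m * δ)), (∀ u ∈ U, (Matrix.of fun a b : Fin m => u (toLex (a, b))).rank ≤ r) ∧ lam.parts.card ≤ m * m ∧ (let χ : Literature.NumberTheory.DiophantineGeometry.Weight (Literature.NumberTheory.DiophantineGeometry.MatIdx m) := (Literature.NumberTheory.DiophantineGeometry.Weight.dualOfPartition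 (m * m) lam).toMatIdx; let T : Submodule ℂ (MvPolynomial (Literature.NumberTheory.DiophantineGeometry.MatIdx m × Literature.NumberTheory.DiophantineGeometry.MatIdx m) ℂ) := MvPolynomial.homogeneousSubmodule (Literature.NumberTheory.DiophantineGeometry.MatIdx m × Literature.NumberTheory.DiophantineGeometry.MatIdx m) ℂ (m * δ) ⊓ ((MvPolynomial.vanishingIdeal ℂ {p : Literature.NumberTheory.DiophantineGeometry.MatIdx m × Literature.NumberTheory.DiophantineGeometry.MatIdx m → ℂ | ∀ j : Literature.NumberTheory.DiophantineGeometry.MatIdx m, (fun i => p (j, i)) ∈ U}) ^ (δ * (m - r))).restrictScalars ℂ ⊓ (⨅ (M : Matrix (Literature.NumberTheory.DiophantineGeometry.MatIdx m) (Literature.NumberTheory.DiophantineGeometry.MatIdx m) ℂ) (_ : Literature.Computability.AlgebraicComplexity.linSubst (Literature.NumberTheory.DiophantineGeometry.MatIdx m) ℂ M (Literature.NumberTheory.DiophantineGeometry.detFormLex ℂ m) = Literature.NumberTheory.DiophantineGeometry.detFormLex ℂ m), LinearMap.ker ((MvPolynomial.aeval (R := ℂ) fun p : Literature.NumberTheory.DiophantineGeometry.MatIdx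 m × Literature.NumberTheory.DiophantineGeometry.MatIdx m => ∑ l : Literature.NumberTheory.DiophantineGeometry.MatIdx m, M l p.2 • MvPolynomial.X (p.1, l)).toLinearMap - LinearMap.id (R := ℂ) (M := MvPolynomial (Literature.NumberTheory.DiophantineGeometry.MatIdx m × Literature.NumberTheory.DiophantineGeometry.MatIdx m) ℂ))) ⊓ (⨅ (g : Matrix.GeneralLinearGroup (Literature.NumberTheory.DiophantineGeometry.MatIdx m) ℂ) (_ : Literature.NumberTheory.DiophantineGeometry.IsUpperTriangular g), LinearMap.ker ((MvPolynomial.aeval (R := ℂ) fun p : Literature.NumberTheory.DiophantineGeometry.MatIdx m × Literature.NumberTheory.DiophantineGeometry.MatIdx m => ∑ l : Literature.NumberTheory.DiophantineGeometry.MatIdx m, ((g⁻¹ : Matrix.GeneralLinearGroup (Literature.NumberTheory.DiophantineGeometry.MatIdx m) ℂ) : Matrix (Literature.NumberTheory.DiophantineGeometry.MatIdx m) (Literature.NumberTheory.DiophantineGeometry.MatIdx m) ℂ) p.1 l • MvPolynomial.X (l, p.2)).toLinearMap - Literature.NumberTheory.DiophantineGeometry.weightChar χ g • LinearMap.id (R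 := ℂ) (M := MvPolynomial (Literature.NumberTheory.DiophantineGeometry.MatIdx m × Literature.NumberTheory.DiophantineGeometry.MatIdx m) ℂ))); Module.finrank ℂ ↥T < Literature.NumberTheory.DiophantineGeometry.orbitMultiplicity ℂ (Literature.NumberTheory.DiophantineGeometry.paddedPerFormLex ℂ n m) m χ)

/-- item stmt-ValiantsHypothesis-15687 · crux · rank 6 · closed · moot by None · by planner
why it might fail: Exactly ValuativeFlip's risk on its own range: past linear padding dim T_U(lam) may dominate mult_pp as Kronecker coefficients do (IP17 Thm 4, m > 3n^4); bounded-length shapes carry no obstruction once m >= 1+n(n+1)^l (landed); no per-side engine beyond sqrt2 n.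
sources: arXiv:1512.03798, arXiv:1604.06431, arXiv:1911.03990, doi:10.4086/toc.gs.2025.010, arXiv:0907.2850
[crux] TAIL of the window (second child of the strategist's split of ValuativeFlip, 2026-08-16;
filed by route-repair to connect HeadFlip to `closes`): for EVERY rational slope a/b > 1 and every
c, for all large n and every m with (a/b) n < m <= 2^((log2 n + c)^c), there are a linear space U of
m x m matrices all of rank <= r, a degree delta and a partition lam of m*delta with <= m^2 parts
such that the valuative truncation T_U(lam) (verbatim the flip body of ValuativeFlip / HeadFlip:
homogeneous of degree m*delta, vanishing to order >= delta(m-r) along L_U, Stab(det_m)-invariant,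
B-semi-invariant of weight lam*) has dimension STRICTLY SMALLER than mult_{lam*} C[Delta_m(X00^{m-n}
per_n)] (orbitMultiplicity of paddedPerFormLex). Implied by ValuativeFlip (it is ValuativeFlip
restricted to the tail; `tailFlip_of_valuativeFlip` in the repair sketch) and HeadFlip -> TailFlip
-> ValuativeFlip (item ValuativeFlipSplit, pure logic, Cruxes/ValuativeFlip/Split.lean). It keeps
the WHOLE residual difficulty of ValuativeFlip: multiplicity obstructions beyond linear padding (all
of c >= 2, and (sqrt2 n, 2n] of c = 1), where no bounded number of rows flips the total count (per k
n^2-2n+k+1 vs det -/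
@[route_item "route-ValiantsHypothesis-ValuativeGCT", crux]
def TailFlip : Prop :=
  ∀ a b : ℕ, b < a → ∀ c : ℕ, ∃ n₀ : ℕ, ∀ n ≥ n₀, ∀ (m : ℕ) [NeZero m], a * n < b * m → m ≤ 2 ^ ((Nat.log 2 n + c) ^ c) → ∃ (U : Submodule ℂ (Literature.NumberTheory.DiophantineGeometry.MatIdx m → ℂ)) (r δ : ℕ) (lam : Nat.Partition (m * δ)), (∀ u ∈ U, (Matrix.of fun a b : Fin m => u (toLex (a, b))).rank ≤ r) ∧ lam.parts.card ≤ m * m ∧ (let χ : Literature.NumberTheory.DiophantineGeometry.Weight (Literature.NumberTheory.DiophantineGeometry.MatIdx m) := (Literature.NumberTheory.DiophantineGeometry.Weight.dualOfPartition (m * m) lam).toMatIdx; let T : Submodule ℂ (MvPolynomial (Literature.NumberTheory.DiophantineGeometry.MatIdx m × Literature.NumberTheory.DiophantineGeometry.MatIdx m) ℂ) := MvPolynomial.homogeneousSubmodule (Literature.NumberTheory.DiophantineGeometry.MatIdx m × Literature.NumberTheory.DiophantineGeometry.MatIdx m) ℂ (m * δ) ⊓ ((MvPolynomial.vanishingIdeal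 ℂ {p : Literature.NumberTheory.DiophantineGeometry.MatIdx m × Literature.NumberTheory.DiophantineGeometry.MatIdx m → ℂ | ∀ j : Literature.NumberTheory.DiophantineGeometry.MatIdx m, (fun i => p (j, i)) ∈ U}) ^ (δ * (m - r))).restrictScalars ℂ ⊓ (⨅ (M : Matrix (Literature.NumberTheory.DiophantineGeometry.MatIdx m) (Literature.NumberTheory.DiophantineGeometry.MatIdx m) ℂ) (_ : Literature.Computability.AlgebraicComplexity.linSubst (Literature.NumberTheory.DiophantineGeometry.MatIdx m) ℂ M (Literature.NumberTheory.DiophantineGeometry.detFormLex ℂ m) = Literature.NumberTheory.DiophantineGeometry.detFormLex ℂ m), LinearMap.ker ((MvPolynomial.aeval (R := ℂ) fun p : Literature.NumberTheory.DiophantineGeometry.MatIdx m × Literature.NumberTheory.DiophantineGeometry.MatIdx m => ∑ l : Literature.NumberTheory.DiophantineGeometry.MatIdx m, M l p.2 • MvPolynomial.X (p.1, l)).toLinearMap - LinearMap.id (R := ℂ) (M := MvPolynomial (Literature.NumberTheory.DiophantineGeometry.MatIdx m × Literature.NumberTheory.DiophantineGeometry.MatIdx m) ℂ))) ⊓ (⨅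 (g : Matrix.GeneralLinearGroup (Literature.NumberTheory.DiophantineGeometry.MatIdx m) ℂ) (_ : Literature.NumberTheory.DiophantineGeometry.IsUpperTriangular g), LinearMap.ker ((MvPolynomial.aeval (R := ℂ) fun p : Literature.NumberTheory.DiophantineGeometry.MatIdx m × Literature.NumberTheory.DiophantineGeometry.MatIdx m => ∑ l : Literature.NumberTheory.DiophantineGeometry.MatIdx m, ((g⁻¹ : Matrix.GeneralLinearGroup (Literature.NumberTheory.DiophantineGeometry.MatIdx m) ℂ) : Matrix (Literature.NumberTheory.DiophantineGeometry.MatIdx m) (Literature.NumberTheory.DiophantineGeometry.MatIdx m) ℂ) p.1 l • MvPolynomial.X (l, p.2)).toLinearMap - Literature.NumberTheory.DiophantineGeometry.weightChar χ g • LinearMap.id (R := ℂ) (M := MvPolynomial (Literature.NumberTheory.DiophantineGeometry.MatIdx m × Literature.NumberTheory.DiophantineGeometry.MatIdx m) ℂ))); Module.finrank ℂ ↥T < Literature.NumberTheory.DiophantineGeometry.orbitMultiplicity ℂ (Literature.NumberTheory.DiophantineGeometry.paddedPerFormLex ℂ n m) m χ)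

/-- item stmt-ValiantsHypothesis-0889 · support · rank 9 · closed · proved by Summit.ValiantsHypothesis.ValiantsHypothesis.Theorems.GctMultPrinciple_proof (prover) · by planner
sources: arXiv:0907.2850, MulmuleySohoni2008, arXiv:1604.06431
[support] Multiplicity obstruction principle, weight form (known [MulmuleySohoni2008; BLMW2011 Prop
3.3.2 and §4; BurgisserIkenmeyerPanova2019 §1]): if some highest weight χ has larger multiplicity in
ℂ[Δ(padded per_n)] than in ℂ[Δ(det_m)] then X₀₀^{m-n} per_n ∉ Δ(det_m). Proof plan: membership
transports to the lex variables (fact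
Literature.NumberTheory.DiophantineGeometry.rename_mem_orbitClosure_rename_iff /
hasBorderDetRepr_iff_rename), gives the equivariant surjection orbitCoordRestrict ℂ[Δ det] ↠ ℂ[Δ pp]
(in tree); a weight pins the degree (fact finiteDimensional_highestWeightSpace_orbitCoordRep),
degree pieces are f.d. rational GL-representations, hence semisimple (fact
isSemisimpleRepresentation_of_isRationalRep), so the surjection splits and highest-weight spaces
surject: hwMultiplicity(pp) χ ≤ hwMultiplicity(det) χ. Provers may take the three named facts as
hypotheses (then re-file with (h : Fact) →). ~80 lines. -/
@[route_item "route-ValiantsHypothesis-ValuativeGCT"]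
def GctMultPrinciple : Prop :=
  ∀ (n m : ℕ) [NeZero m] (χ : Literature.NumberTheory.DiophantineGeometry.Weight (Literature.NumberTheory.DiophantineGeometry.MatIdx m)), n ≤ m → Literature.NumberTheory.DiophantineGeometry.orbitMultiplicity ℂ (Literature.NumberTheory.DiophantineGeometry.detFormLex ℂ m) m χ < Literature.NumberTheory.DiophantineGeometry.orbitMultiplicity ℂ (Literature.NumberTheory.DiophantineGeometry.paddedPerFormLex ℂ n m) m χ → Literature.Computability.AlgebraicComplexity.paddedPerPoly ℂ n m ∉ Literature.Computability.AlgebraicComplexity.orbitClosure (Literature.Computability.AlgebraicComplexity.detPoly (Fin m) ℂ)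

/-- item stmt-ValiantsHypothesis-0983 · support · rank 9 · closed · proved by Summit.ValiantsHypothesis.ValiantsHypothesis.Theorems.BorderApolarityGctBridge.gctBridge_route_proof @ b072793f699b (prover) · by planner
sources: MulmuleySohoni2001, arXiv:0907.2850, Burgisser2000
[support] Bookkeeping, provable now from PROVED cone facts: the qp Mulmuley-Sohoni thesis (=
GCTMult.GctThesis, stmt-0323) implies ValiantsHypothesis, by composing
Literature.CplxAlg.gct_assembly (Theorems/GCTMultAssembly.lean) with
paddedPerPoly_mem_orbitClosure_detPoly_of_hasDetRepr_holds, hasDetRepr_determinantalComplexity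
(discharged), HasDetRepr.mono, isQPBounded_determinantalComplexity_of_isVPFamily_holds,
mem_VP_ofFintype_iff_holds, perFamily_mem_VNP_holds and
Summit.ValiantsHypothesis.Hub.valiantsHypothesis_of_not_isVPFamily_per (Theorems/HubHub.lean).
Shared glue usable by GCTMult as well. -/
@[route_item "route-ValiantsHypothesis-ValuativeGCT"]
def GctToVH : Prop :=
  (∀ c : ℕ, ∃ n₀ : ℕ, ∀ n ≥ n₀, ∀ (m : ℕ) [NeZero m], n ≤ m → m ≤ 2 ^ ((Nat.log 2 n + c) ^ c) → Literature.Computability.AlgebraicComplexity.paddedPerPoly ℂ n m ∉ Literature.Computability.AlgebraicComplexity.orbitClosure (Literature.Computability.AlgebraicComplexity.detPoly (Fin m) ℂ)) → ValiantsHypothesis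

/-- `GctToVH` holds: proved by `Summit.ValiantsHypothesis.ValiantsHypothesis.Theorems.BorderApolarityGctBridge.gctBridge_route_proof` @ b072793f699b. -/
theorem GctToVH_holds : GctToVH := _root_.Summit.ValiantsHypothesis.ValiantsHypothesis.Theorems.BorderApolarityGctBridge.gctBridge_route_proof

/-- item stmt-ValiantsHypothesis-12627 · support · rank 9 · closed · proved by Summit.ValiantsHypothesis.ValiantsHypothesis.Theorems.orbitMapKernel_proof @ 1b9ba0927858 (prover) · by planner
sources: arXiv:0907.2850, MulmuleySohoni2001, Literature.Computability.AlgebraicComplexity.endOrbit_subset_orbitClosure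
[support] Kernel of the End-orbit pull-back (feeds ValuativeBound): a polynomial F in the degree-m
coefficients vanishes on the GL_{m^2}-orbit of det_m iff F(coefficients of det_m(x A)) is the zero
polynomial in the entries of the generic matrix A (GL is Zariski dense in End over C: multiply by
det A). Elementary. [difficulty: provable-now] -/
@[route_item "route-ValiantsHypothesis-ValuativeGCT"]
def OrbitMapKernel : Prop :=
  ∀ (m : ℕ) (F : MvPolynomial (Literature.Computability.AlgebraicComplexity.DegIdx (Literature.NumberTheory.DiophantineGeometry.MatIdx m) m) ℂ), F ∈ Literature.Computability.AlgebraicComplexity.orbitVanishingIdeal (Literature.NumberTheory.DiophantineGeometry.detFormLex ℂ m) m ↔ (MvPolynomial.aeval (R := ℂ) fun d : Literature.Computability.AlgebraicComplexity.DegIdx (Literature.NumberTheory.DiophantineGeometry.MatIdx m) m => MvPolynomial.coeff d.1 (Literature.Computability.AlgebraicComplexity.linSubst (Literature.NumberTheory.DiophantineGeometry.MatIdx m) (MvPolynomial (Literature.NumberTheory.DiophantineGeometry.MatIdx m × Literature.NumberTheory.DiophantineGeometry.MatIdx m) ℂ) (Matrix.of fun j i : Literature.NumberTheory.DiophantineGeometry.MatIdx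 m => MvPolynomial.X (j, i)) (MvPolynomial.map MvPolynomial.C (Literature.NumberTheory.DiophantineGeometry.detFormLex ℂ m)))) F = 0

/-- item stmt-ValiantsHypothesis-12628 · support · rank 9 · closed · proved by Summit.ValiantsHypothesis.ValiantsHypothesis.Theorems.CoeffVanishingOrder.CoeffVanishingOrder_proof @ b03e6b617908 (prover) · by planner
sources: arXiv:1512.02437, arXiv:1004.4802
[support] The valuative estimate (feeds ValuativeBound): if every matrix in the linear space U has
rank <= r then every coefficient (in x) of det_m(x A), as a polynomial in the entries of A, lies in
the (m - r)-th power of the vanishing ideal of L_U = {A : all rows in U}: expand det(Y0 + Y1)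
column-wise with Y0 = (xA0) of rank <= r over C(x); terms with more than r columns from Y0 vanish,
the rest have >= m - r columns linear in A1; powers of the ideal of a linear subspace are the
order-of-vanishing ideals. [difficulty: provable-now] -/
@[route_item "route-ValiantsHypothesis-ValuativeGCT", crux]
def CoeffVanishingOrder : Prop :=
  ∀ (m : ℕ) (U : Submodule ℂ (Literature.NumberTheory.DiophantineGeometry.MatIdx m → ℂ)) (r : ℕ), (∀ u ∈ U, (Matrix.of fun a b : Fin m => u (toLex (a, b))).rank ≤ r) → ∀ d : Literature.Computability.AlgebraicComplexity.DegIdx (Literature.NumberTheory.DiophantineGeometry.MatIdx m) m, (MvPolynomial.aeval (R := ℂ) fun d : Literature.Computability.AlgebraicComplexity.DegIdx (Literature.NumberTheory.DiophantineGeometry.MatIdx m) m => MvPolynomial.coeff d.1 (Literature.Computability.AlgebraicComplexity.linSubst (Literature.NumberTheory.DiophantineGeometry.MatIdx m) (MvPolynomial (Literature.NumberTheory.DiophantineGeometry.MatIdx m × Literature.NumberTheory.DiophantineGeometry.MatIdx m) ℂ) (Matrix.of fun j i : Literature.NumberTheory.DiophantineGeometry.MatIdx m => MvPolynomial.X (j,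 i)) (MvPolynomial.map MvPolynomial.C (Literature.NumberTheory.DiophantineGeometry.detFormLex ℂ m)))) (MvPolynomial.X d) ∈ (MvPolynomial.vanishingIdeal ℂ {p : Literature.NumberTheory.DiophantineGeometry.MatIdx m × Literature.NumberTheory.DiophantineGeometry.MatIdx m → ℂ | ∀ j : Literature.NumberTheory.DiophantineGeometry.MatIdx m, (fun i => p (j, i)) ∈ U}) ^ (m - r)

/-- item stmt-ValiantsHypothesis-12629 · support · rank 9 · closed · moot by None · by planner
sources: arXiv:1604.06431, arXiv:1512.03798, doi:10.4086/toc.gs.2025.010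
[support] NEGATIVE SIDE / kill statement (the card's fastest refutation, valuative analogue of
GCTMult.GctNoMultBarrier): from some polynomial padding m >= n^{c0} on, for EVERY singular-space
truncation (U, r) and every (delta, lam) the padded-permanent multiplicity of lam* is at most dim
T_U(lam). A proof refutes ValuativeFlip (the window contains m = n^{c0}) and is evidence for
GctNoMultBarrier (stmt-0890). Filed unranked; rank it if CutBites dies for m >= 5. [difficulty:
open-problem] -/
@[route_item "route-ValiantsHypothesis-ValuativeGCT"]
def NoValuativeFlip : Prop :=
  ∃ c₀ n₀ : ℕ, ∀ n ≥ n₀, ∀ (m : ℕ) [NeZero m], n ^ c₀ ≤ m → ∀ (U : Submodule ℂ (Literature.NumberTheory.DiophantineGeometry.MatIdx m → ℂ)) (r : ℕ), (∀ u ∈ U, (Matrix.of fun a b : Fin m => u (toLex (a, b))).rank ≤ r) → ∀ (δ : ℕ) (lam : Nat.Partition (m * δ)), lam.parts.card ≤ m * m → let χ : Literature.NumberTheory.DiophantineGeometry.Weight (Literature.NumberTheory.DiophantineGeometry.MatIdx m) := (Literature.NumberTheory.DiophantineGeometry.Weight.dualOfPartition (m * m) lam).toMatIdx; let T : Submodule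 ℂ (MvPolynomial (Literature.NumberTheory.DiophantineGeometry.MatIdx m × Literature.NumberTheory.DiophantineGeometry.MatIdx m) ℂ) := MvPolynomial.homogeneousSubmodule (Literature.NumberTheory.DiophantineGeometry.MatIdx m × Literature.NumberTheory.DiophantineGeometry.MatIdx m) ℂ (m * δ) ⊓ ((MvPolynomial.vanishingIdeal ℂ {p : Literature.NumberTheory.DiophantineGeometry.MatIdx m × Literature.NumberTheory.DiophantineGeometry.MatIdx m → ℂ | ∀ j : Literature.NumberTheory.DiophantineGeometry.MatIdx m, (fun i => p (j, i)) ∈ U}) ^ (δ * (m - r))).restrictScalars ℂ ⊓ (⨅ (M : Matrix (Literature.NumberTheory.DiophantineGeometry.MatIdx m) (Literature.NumberTheory.DiophantineGeometry.MatIdx m) ℂ) (_ : Literature.Computability.AlgebraicComplexity.linSubst (Literature.NumberTheory.DiophantineGeometry.MatIdx m) ℂ M (Literature.NumberTheory.DiophantineGeometry.detFormLex ℂ m) = Literature.NumberTheory.DiophantineGeometry.detFormLex ℂ m), LinearMap.ker ((MvPolynomial.aeval (R := ℂ) fun p : Literature.NumberTheory.DiophantineGeometry.MatIdx m × Literature.NumberTheory.DiophantineGeometry.MatIdx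 m => ∑ l : Literature.NumberTheory.DiophantineGeometry.MatIdx m, M l p.2 • MvPolynomial.X (p.1, l)).toLinearMap - LinearMap.id (R := ℂ) (M := MvPolynomial (Literature.NumberTheory.DiophantineGeometry.MatIdx m × Literature.NumberTheory.DiophantineGeometry.MatIdx m) ℂ))) ⊓ (⨅ (g : Matrix.GeneralLinearGroup (Literature.NumberTheory.DiophantineGeometry.MatIdx m) ℂ) (_ : Literature.NumberTheory.DiophantineGeometry.IsUpperTriangular g), LinearMap.ker ((MvPolynomial.aeval (R := ℂ) fun p : Literature.NumberTheory.DiophantineGeometry.MatIdx m × Literature.NumberTheory.DiophantineGeometry.MatIdx m => ∑ l : Literature.NumberTheory.DiophantineGeometry.MatIdx m, ((g⁻¹ : Matrix.GeneralLinearGroup (Literature.NumberTheory.DiophantineGeometry.MatIdx m) ℂ) : Matrix (Literature.NumberTheory.DiophantineGeometry.MatIdx m) (Literature.NumberTheory.DiophantineGeometry.MatIdx m) ℂ) p.1 l • MvPolynomial.X (l, p.2)).toLinearMap - Literature.NumberTheory.DiophantineGeometry.weightChar χ g • LinearMap.id (R := ℂ) (M := MvPolynomial (Literature.NumberTheory.DiophantineGeometry.MatIdx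 m × Literature.NumberTheory.DiophantineGeometry.MatIdx m) ℂ))); Literature.NumberTheory.DiophantineGeometry.orbitMultiplicity ℂ (Literature.NumberTheory.DiophantineGeometry.paddedPerFormLex ℂ n m) m χ ≤ Module.finrank ℂ ↥T

/-- item stmt-ValiantsHypothesis-15688 · support · rank 9 · closed · proved by Summit.ValiantsHypothesis.ValiantsHypothesis.Theorems.ValuativeFlip.valuativeFlipSplit_proof @ 24a778eba535 (prover) · by planner
sources: arXiv:0907.2850, MulmuleySohoni2001
[support] GLUE of the split of ValuativeFlip: HeadFlip -> TailFlip -> ValuativeFlip. Pure logic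
(take n0 = max of the head and tail thresholds for the head's slope a/b and case-split on b*m <=
a*n); sorry-free proofs exist verbatim: `ValuativeFlip_of_subs` in Cruxes/ValuativeFlip/Split.lean
(strategist) and `valuativeFlipSplit_proof` in the route-repair Sketch.lean (lean check rc 0, axioms
propext/Classical.choice/Quot.sound). To close it, land `theorem valuativeFlipSplit_proof :
ValuativeGCT.ValuativeFlipSplit` under Summits/ValiantsHypothesis/ValiantsHypothesis/Theorems (~12
lines). This item is what puts HeadFlip (and TailFlip) in the cone of `closes`; `closes` itself
keeps its four hypotheses ValuativeBound, ValuativeFlip, GctMultPrinciple, GctToVH. [deps: HeadFlip,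
TailFlip, ValuativeFlip] [difficulty: provable-now] -/
@[route_item "route-ValiantsHypothesis-ValuativeGCT"]
def ValuativeFlipSplit : Prop :=
  HeadFlip → TailFlip → ValuativeFlip

/-- item stmt-ValiantsHypothesis-15804 · support · rank 9 · closed · proved by Summit.ValiantsHypothesis.ValiantsHypothesis.Theorems.ValuativeFlip.valuativeFlipToHead_proof @ 24a778eba535 (prover) · by planner
sources: arXiv:0907.2850, MulmuleySohoni2001
[support] CONVERSE glue of the split of ValuativeFlip, head direction: ValuativeFlip -> HeadFlip.
Pure logic: take slope a/b = 2/1 and the window exponent c = 2; for n <= m <= 2n one has m <= 2n <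
2^(Nat.log 2 n + 2) <= 2^((Nat.log 2 n + 2)^2) (Nat.lt_pow_succ_log_self, pow monotonicity), so
ValuativeFlip at c = 2 supplies the flip. Sorry-free `valuativeFlipToHead_proof` in the route-repair
Sketch.lean (lean check rc 0, ~10 lines: obtain n0 from h 2; refine <2, 1, _, n0, _>;
omega/nlinarith bookkeeping). Purpose: with ValuativeFlipToTail the strategist's split is an
EQUIVALENCE ValuativeFlip <-> HeadFlip ∧ TailFlip; a direct proof of ValuativeFlip then discharges
the `closes` binder HeadFlip in one line, and the views show HeadFlip as derived from ValuativeFlip.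
[deps: ValuativeFlip, HeadFlip] [difficulty: provable-now] -/
@[route_item "route-ValiantsHypothesis-ValuativeGCT"]
def ValuativeFlipToHead : Prop :=
  ValuativeFlip → HeadFlip

/-- item stmt-ValiantsHypothesis-15805 · support · rank 9 · closed · proved by Summit.ValiantsHypothesis.ValiantsHypothesis.Theorems.ValuativeFlip.valuativeFlipToTail_proof @ 24a778eba535 (prover) · by planner
sources: arXiv:0907.2850, MulmuleySohoni2001
[support] CONVERSE glue of the split of ValuativeFlip, tail direction: ValuativeFlip -> TailFlip.
Pure logic: given a slope a/b > 1 and c, take n0 from ValuativeFlip c; a*n < b*m with b < a gives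
b*n <= a*n < b*m hence n < m, so the window hypothesis n <= m holds and ValuativeFlip supplies the
flip. Sorry-free `valuativeFlipToTail_proof` (= `tailFlip_of_valuativeFlip`) in the route-repair
Sketch.lean (lean check rc 0, 8 lines). Purpose: a direct proof of ValuativeFlip discharges the
`closes` binder TailFlip in one line; the views show TailFlip as derived from ValuativeFlip. [deps:
ValuativeFlip, TailFlip] [difficulty: provable-now] -/
@[route_item "route-ValiantsHypothesis-ValuativeGCT"]
def ValuativeFlipToTail : Prop :=
  ValuativeFlip → TailFlip

/-- item stmt-ValiantsHypothesis-12630 · assembly · rank 1 · closed · proved by Summit.ValiantsHypothesis.ValiantsHypothesis.Theorems.assembly_proof @ 074fd9a481a7 (prover) · by planner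
sources: arXiv:0907.2850, MulmuleySohoni2001
[assembly] ValuativeBound -> ValuativeFlip -> GctMultPrinciple -> GctToVH -> ValiantsHypothesis
(pure logic; the deciding theorem `closes` in glue.lean has exactly these four hypotheses). -/
@[route_item "route-ValiantsHypothesis-ValuativeGCT"]
def Assembly : Prop :=
  ValuativeBound → ValuativeFlip → GctMultPrinciple → GctToVH → ValiantsHypothesis

end Summit.ValiantsHypothesis.ValiantsHypothesis.Theses.ValuativeGCT
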